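/-
Copyright (c) 2026 the pub-hodgecm-mathlib formalisation cell (harness21).  Prover seat hodgecm-mathlib-F0P3-p01 (g18), 2026-09-01.  ED. 38 «PK-ε» (RULING D53-pre, LEAD T11-64∕66∕69∕71):
★5 — the witnessed package `SpecPkg S₀` of the kit of record WITH THE ROOT-NUMBER SIGN, from the residual print letter «K9-STF» in its W-form.
-/
import Summits.HodgeConjecture.HodgeConjecture.Theorems.F0P3GHSideOfFibres                 -- ★ (F0P3-p04 (g9), K9-0a(a)): `ghOfFibres`, `matchingS_kitOfRecord_ghOfFibres`, `transferS_kitOfRecord_ghOfFibres` (+ ★ `F0P3KitOfRecordLawsV8`: `SpecPkg`)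
import Summits.HodgeConjecture.HodgeConjecture.Theorems.F0P3bLocalExpansionAtKitOfRecord    -- ★ (F0P3b desk): `HTraceProductForm` (H-side clause, reused BY NAME)
import Summits.HodgeConjecture.HodgeConjecture.Theorems.F0P3ClassificationBridgeV8           -- ★ (F0P3-p03 (g7)): `localExpansion_of_v6`
import Summits.HodgeConjecture.HodgeConjecture.Theorems.F0P3KitOfRecordW                   -- ★1 (pen F0P3a-p02 (g15)): `kitOfRecordW`, `matchingS_kitOfRecordW_ghOfFibres`, `transferS_kitOfRecordW_ghOfFibres`
import Summits.HodgeConjecture.HodgeConjecture.Theorems.F0P3bLocalExpansionAtKitOfRecordW   -- ★2 (P3b): `GTraceProductFormW`, `localExpansion_kitOfRecordW`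
import HarnessLib

/-!
# ED. 38 «PK-ε», ★5 — ROW K9-5 WITH THE ROOT-NUMBER SIGN: `SpecPkg S₀` OF `kitOfRecordW` FROM THE W-FORM OF LETTER «K9-STF» (Rogawski §14.6; erratum Rogawski (1992) Thm. 1.2)

Cell `hodgecm-mathlib`, F0∕P3 «U3-mult», crux H413 (`stmt-HodgeConjecture-24833`); ED. 38 «PK-ε» (ref1-OBJ-3; LEAD T11-64∕66∕69∕71; desk RULING D53-pre PART A ★5), pen F0P3-p01 (g18).
PROOF LANE: theorems only; no `def`, no instance, no notation, no named fact, no `sorry`; `--supports stmt-HodgeConjecture-24833`.  Count-neutral.  HONEST LABEL: HC_CM is proved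
only modulo the printed citations until rung 0 closes.

WHAT THIS FILE IS FOR.  The twin of ★ `F0P3OverrideWitnessOfLetters` §1–§2 (:70–:119) at the kit WITH the per-ξ root-number sign, `𝔠₀^W := kitOfRecordW … μω wXi c …` (★1
`F0P3KitOfRecordW`: `N ξ = N₀ + [w_ξ = −1]`, `sgnG ξ = w_ξ · c`; Rogawski (1992) Thm. 1.2: `m(π) = ½(1 + W(ξ)(−1)^{n(π)+N})`, `W(ξ) = ε(½, φ_ξ)`).  The G-side product-trace
clause is the W-form ★2 `GTraceProductFormW` (ONE factor `w_ξ` on the SIGNED term; LEAD T11-66, P3b (P6)); the H-side clause ★ `HTraceProductForm` is unchanged and reused BY NAME;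
`matchingS` ∕ `transferS` hold by construction at `gh := ghOfFibres …` (★ K9-0a(a), transported to `𝔠₀^W` by ★1); `localExpansion` is ★2 `localExpansion_kitOfRecordW` fed with
`w_ξ = ±1`, `c = ±1` and the two clauses, lifted v6 → v8 (★ `localExpansion_of_v6`).
* `gTraceProductFormW_ghOfFibres_of_forall` (§1): `GTraceProductFormW` at `gh := ghOfFibres …` from its one-variable form (twin of ★ :73);
* **`specPkg_kitOfRecordW_ghOfFibres_of_productFormW`** (§2): `SpecPkg 𝔠₀^W S₀` from `hw : ∀ ξ, w_ξ = 1 ∨ w_ξ = −1`, `hc : c = 1 ∨ c = −1`, `FactorisationPk 𝔠₀^W S₀`,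
  `APacketSpectral 𝔠₀^W S₀`, `GTraceProductFormW`, `HTraceProductForm` (twin of ★ :108).

References: [Rogawski1990] §13.1 p. 199, §13.2, §13.3 Thms. 13.3.5∕13.3.7, §14.2 (14.2.1) p. 232, §14.6 Thm. 14.6.1 p. 241, Thm. 14.6.4 (14.6.3) p. 244; [Rogawski1992] Thm. 1.2 p. 397;
[Flath1979] Thm. 3.
-/

set_option autoImplicit false
set_option linter.dupNamespace false

noncomputable section

open NumberField IsDedekindDomain MeasureTheory
open Literature.NumberTheory.Rogawski1990 Literature.NumberTheory.GaloisRepresentations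
open Literature.NumberTheory.Automorphic Literature.NumberTheory.Automorphic.UnitaryGroup
open scoped Matrix ComplexOrder BigOperators Classical

open Summit.HodgeConjecture.HodgeConjecture.Cruxes.H413.F0P3InnerFormClassificationV6 (Gp Places Cinf Sockets TestGp TestG TestH ClassificationKit)
open Summit.HodgeConjecture.HodgeConjecture.Cruxes.H413.F0P3InnerFormClassificationV6.ClassificationKit (memberCoeff)
open Summit.HodgeConjecture.HodgeConjecture.Cruxes.H413.F0P3KitOfRecord (GHSide XiSide kitOfRecord cptXi₀)
open Summit.HodgeConjecture.HodgeConjecture.Cruxes.H413.F0P3TestFunctionsOfRecord (Unr₀)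
open Summit.HodgeConjecture.HodgeConjecture.Cruxes.H413.F0P3SemilocalTestFunctionsOfRecord (TestS₀ tens₀)
open Summit.HodgeConjecture.HodgeConjecture.Cruxes.H413.F0P3XiArchDataOfRecord (nCompactOfRecord)
open Summit.HodgeConjecture.HodgeConjecture.Cruxes.H413.F0P3XiArchPacketOfRecord (archPacketOfRecord)
open Summit.HodgeConjecture.HodgeConjecture.Cruxes.H413.F0P3GHSideOfFibres (ghOfFibres matchingS_kitOfRecord_ghOfFibres transferS_kitOfRecord_ghOfFibres)
open Summit.HodgeConjecture.HodgeConjecture.Cruxes.H413.F0P3bLocalExpansionAtKitOfRecord (GTraceProductForm HTraceProductForm localExpansion_kitOfRecord)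
open Summit.HodgeConjecture.HodgeConjecture.Cruxes.H413.F0P3InnerFormClassificationV8.ClassificationKit (localExpansion_of_v6)


open Summit.HodgeConjecture.HodgeConjecture.Cruxes.H413.F0P3KitOfRecordW (kitOfRecordW)
open Summit.HodgeConjecture.HodgeConjecture.Cruxes.H413.F0P3bLocalExpansionAtKitOfRecordW (GTraceProductFormW localExpansion_kitOfRecordW)

namespace Summit.HodgeConjecture.HodgeConjecture.Cruxes.H413.F0P3OverrideWitnessOfLettersW

variable (L : Type) [Field L] [NumberField L] [IsCMField L] (H : Matrix (Fin 3) (Fin 3) L) (ι : L →+* ℂ) (T : GL (Fin 3) ℂ)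
  (hT : (T : Matrix (Fin 3) (Fin 3) ℂ)ᴴ * H.map ι * (T : Matrix (Fin 3) (Fin 3) ℂ) = Literature.Geometry.ComplexHyperbolic.BallModel.J)
  (μ : Measure (Gp L H).automorphicQuotient) [(Gp L H).IsAutomorphicMeasure μ]

variable {L H μ}
variable (𝔰 : Sockets L H μ) (hg : ∀ f' : TestGp L H, 𝔰.Smooth f' → ∃ (f : TestG L) (fH : TestH L), 𝔰.Matches f' f fH)
  (hsm : ∀ (S : Finset (Places L)) (fS : TestS₀ L H ι T hT S) (fT : Unr₀ L H S), 𝔰.Smooth (tens₀ S fS fT))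
  (trGS : ∀ S : Finset (Places L), 𝔰.PacketG → TestS₀ L H ι T hT S → ℂ) (trHS : ∀ S : Finset (Places L), 𝔰.PacketH → TestS₀ L H ι T hT S → ℂ)
  (ξd : XiSide L H 𝔰.PacketG 𝔰.PacketH) (μω : HeckeCharacter L) (wXi : OneDimAutRepH L → ℤ) (c : ℚ) (jInf dsInf : ℤ → ℤ → ℤ → Cinf)
  (archTr : Cinf → (UnitaryGroup.arch (↥(maximalRealSubfield L)) L (IsCMField.complexConj L) 3 H → ℂ) → ℂ)
  (μv : ∀ v : Places L, @Measure ((cmDatum L 3 H).Local v) (borel _))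

/-! ## §1 The W-form of the G-side product-trace clause at the G∕H side of fibres: one-variable form -/

/-- **`GTraceProductFormW` at `gh := ghOfFibres …` from its one-variable form** (twin of ★ `gTraceProductForm_ghOfFibres_of_forall`).  At the G∕H side of fibres the `S`-level
matching relation is `fSG = fS ∧ fSH = fS`, so the W-form of the G-side product-trace clause [Rogawski1990 13.1.3 (b) p. 199; 12.3.3 (b) p. 178; p. 244; sign: Rogawski1992 Thm. 1.2]
is implied by «for every `ξ`, `S ⊇ ram ξ` and `G′`-side datum `f_S`: `Tr Π(ξ)_S(f_S) = [F_ξ = 𝟙] · (−1)^N · w_ξ · (Σ_y coeff⁻(y) A_y(f_∞)) · ∏_{v ∈ S} Σ_z coeff⁻_v(z) Tr z(f_v)`».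
[cite: Rogawski1990, §13.1 13.1.3 (b) p. 199; §12.3 12.3.3 (b) p. 178; §14.6 p. 244] [cite: Rogawski1992, Thm. 1.2 p. 397] -/
theorem gTraceProductFormW_ghOfFibres_of_forall
    (h : ∀ (ξ : OneDimAutRepH L) (S : Finset (Places L)), ξd.ram ξ ⊆ S → ∀ (fS : TestS₀ L H ι T hT S),
      trGS S (ξd.PiXi ξ) fS = (if cptXi₀ ι μω ξ then 1 else 0) * (-1) ^ nCompactOfRecord L * (wXi ξ : ℂ) *
        ((∑ᶠ y, (memberCoeff (archPacketOfRecord ι μω jInf dsInf ξ) (-1) y : ℂ) * archTr y fS.arch) *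
          ∏ v : ↥S, ∑ᶠ z, (memberCoeff (ξd.packFin ξ v.1) (-1) z : ℂ) *
            (letI : MeasurableSpace ((cmDatum L 3 H).Local v.1) := borel _; z.smoothTrace (μv v.1) (fS.loc v)))) :
    GTraceProductFormW ι T hT (ghOfFibres ι T hT 𝔰 hg hsm trGS trHS) ξd μω wXi jInf dsInf archTr μv := by
  intro ξ S hS fS fSG fSH hm
  obtain ⟨h1, -⟩ := hm
  rw [h1]
  exact h ξ S hS fS

/-! ## §2 `SpecPkg S₀` of the kit of record WITH the root-number sign, G∕H side of fibres, from the residual print clauses (W-form) -/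

variable [MeasurableSpace (Gp L H).Adelic] [BorelSpace (Gp L H).Adelic]
variable (ν : Measure (Gp L H).Adelic) [IsFiniteMeasureOnCompacts ν] (ramCls₀ : DiscreteAutomorphicRep (Gp L H) μ → Set (Places L))

/-- **`SpecPkg 𝔠₀^W S₀` FROM THE LETTER'S (P)-CLAUSES, W-FORM** — `𝔠₀^W := kitOfRecordW … 𝔰 (ghOfFibres …) ξd μω wXi c …` (twin of ★ `specPkg_kitOfRecord_ghOfFibres_of_productForm`):
`factorisationPk` and `aPacketSpectral` are passed through (print: [Flath1979 Thm. 3; Rogawski1990 §13.2, §13.7; Thm. 13.3.5, 13.3.7]); `matchingS` ∕ `transferS` hold BY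
CONSTRUCTION (★ K9-0a(a); sign-blind, the ★ terms transported to `𝔠₀^W` through the structure-update); `localExpansion` is ★2 `localExpansion_kitOfRecordW` fed with the sign
laws `w_ξ = ±1` [Rogawski1992 Thm. 1.2], `c = ±1` [p. 243 l. 9 – p. 244 l. 4] and the two product-trace clauses (`GTraceProductFormW`, `HTraceProductForm`), lifted v6 → v8.
[cite: Rogawski1990, §14.6 Thm. 14.6.1 p. 241; Thm. 14.6.4 (14.6.3) p. 244; §13.3 Thm. 13.3.7] [cite: Rogawski1992, Thm. 1.2 p. 397] [cite: FlathCorvallis1979, Thm. 3] -/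
theorem specPkg_kitOfRecordW_ghOfFibres_of_productFormW (S₀ : Finset (Places L)) (hw : ∀ ξ, wXi ξ = 1 ∨ wXi ξ = -1) (hc : c = 1 ∨ c = -1)
    (hP1 : F0P3InnerFormClassificationV8.ClassificationKit.FactorisationPk
      (kitOfRecordW L H ι T hT μ 𝔰 (ghOfFibres ι T hT 𝔰 hg hsm trGS trHS) ξd μω wXi c jInf dsInf archTr ν μv ramCls₀) S₀)
    (hP2 : F0P3InnerFormClassificationV8.ClassificationKit.APacketSpectral
      (kitOfRecordW L H ι T hT μ 𝔰 (ghOfFibres ι T hT 𝔰 hg hsm trGS trHS) ξd μω wXi c jInf dsInf archTr ν μv ramCls₀) S₀)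
    (hG : GTraceProductFormW ι T hT (ghOfFibres ι T hT 𝔰 hg hsm trGS trHS) ξd μω wXi jInf dsInf archTr μv)
    (hH : HTraceProductForm ι T hT (ghOfFibres ι T hT 𝔰 hg hsm trGS trHS) ξd μω c jInf dsInf archTr μv) :
    F0P3InnerFormClassificationV8.ClassificationKit.SpecPkg
      (kitOfRecordW L H ι T hT μ 𝔰 (ghOfFibres ι T hT 𝔰 hg hsm trGS trHS) ξd μω wXi c jInf dsInf archTr ν μv ramCls₀) S₀ :=
  ⟨hP1, matchingS_kitOfRecord_ghOfFibres ι T hT 𝔰 hg hsm trGS trHS ξd μω c jInf dsInf archTr ν μv ramCls₀ S₀,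
    transferS_kitOfRecord_ghOfFibres ι T hT 𝔰 hg hsm trGS trHS ξd μω c jInf dsInf archTr ν μv ramCls₀ S₀, hP2,
    localExpansion_of_v6 _ (localExpansion_kitOfRecordW L H ι T hT μ 𝔰 (ghOfFibres ι T hT 𝔰 hg hsm trGS trHS) ξd μω wXi c jInf dsInf archTr ν μv ramCls₀ hw hc hG hH) S₀⟩

end Summit.HodgeConjecture.HodgeConjecture.Cruxes.H413.F0P3OverrideWitnessOfLettersW

end
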